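import Summits.HodgeConjecture.HodgeConjecture.Theorems.F0P3aStubS1TraceFunctional
import HarnessLib

/-!
# FLOOR-0 ENGINE T1, line `F0_T1InnerFormTraceIdentity` — S1 follow-up: the trace functional MADE EXPLICIT, and S1 is non-vacuous

Cell hodgecm-mathlib, FLOOR 0, crux item H413 = stmt-HodgeConjecture-24833; line `Cruxes/H413/Lines/F0_T1InnerFormTraceIdentity.lean`
(ed. 1.3–1.5; stub S1 `stub_T1a_traceFunctional` CLOSED by ★ `F0P3aStubS1TraceFunctional.stubS1_holds`, p793187).  PROOF lane; seat
F0P3a-p01 (g0); answers referee NOTE-R1-7 (F0P3a-ref1, `REPORT-R1-2.md`): «θ is opaque off the cone `{f′ ⋆ f′^*}`; T1a for a constructed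
kit will need the explicit θ — re-expose it».

## Content (theorems only; no definition, no `sorry`, no instance attribute)
§1 For ANY adelic group datum `𝒢` with `G(𝔸_K)` locally compact second countable Hausdorff, `H = A_G · G(K)` closed and unimodular (`ρ` two-sided
   invariant on it), an automorphic `μ` on a COMPACT quotient `X` and a Haar `ν`, with `K_F = quotientKernel H ρ F` the tree's automorphic kernel
   and `c = unfoldingConstant H ρ μ ν` (the quotient `G(𝔸_K) ⧸ H` carrying the tree's Borel structure `AdelicGroupData.measurableSpaceQuotientForm`,
   inlined in the statements — no local instance is declared):
   * `integrable_quotientKernel_diag` — the diagonal `x ↦ K_F(x, x)` is `μ`-integrable (continuous and bounded, ★ `exists_norm_quotientKernel_le'`);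
   * `integral_quotientKernel_diag_add` ∕ `integral_quotientKernel_diag_smul` — `F ↦ ∫_X K_F(x, x) dμ` is additive and homogeneous
     (★ `quotientKernel_add`, ★ `quotientKernel_const_smul` of the S1 file);
   * `exists_traceFunctional_eq` — **the trace functional with its FORMULA**: `∃ θ : C_c(G(𝔸_K), ℂ) →ₗ[ℂ] ℂ` with
     `θ F = c⁻¹ ∫_X K_F(x, x) dμ` for EVERY `F ∈ C_c` AND the Hilbert–Schmidt clause of S1 on every `f′ ⋆ f′^*`
     (★ `hasSum_norm_sq_integratedOperator_rightRegular_eq_diagonal`) — the statement ★ `exists_traceFunctional` with `θ` no longer opaque.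
§2 Specialisation to `U(H)`, `H ∈ M₃(L)` anisotropic over a CM field: `stubS1_explicit` — for every two-sided, inversion-invariant `ρ ≠ 0` on the
   discrete `U(H)(L⁺)` (e.g. the counting measure used by `stubS1_holds`), `∃ θ` with the formula and the S1 clause.
§3 NON-VACUITY of S1 (referee R1 (ii); no anisotropy needed): `exists_hasSum_norm_sq_integratedOperator_pos` — for a Dirac-like `f′` (★
   `exists_dirac_function'`) `R(f′) 1 ≠ 0` (★ `exists_nhds_integratedOperator_apply_ne_zero`; `1 ∈ L²(X, μ)` is non-zero as `μ ≠ 0` is finite),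
   so for EVERY Hilbert basis the Hilbert–Schmidt sum of `R(f′)`, if convergent, is `> 0`; `stubS1_nonvacuous` (the pair `(f′, f′ ⋆ f′^*)`,
   ★ `mulConvMulStar_nonvacuous`) and `stubS1_re_pos`: EVERY `θ` satisfying the S1 clause has `Re θ(F′) > 0`, `θ(F′) ≠ 0` on some
   `F′ = f′ ⋆ f′^*` — `θ := 0` does not close S1.

HONEST LABEL: HC_CM is proved only modulo the printed citations until rung 0 closes; this file closes nothing new (S1 is already closed) — it
sharpens the S1 artefact for sub-line T1-orb (explicit `θ_{G′}`) and for the referee's vacuity audit.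

## References
* [Gelbart1975] S. Gelbart, *Automorphic forms on adele groups*, Ann. of Math. Stud. 83 (1975), (9.11), Lemma 10.6, (10.10).
* [Rogawski1990] J. Rogawski, Ann. of Math. Stud. 123 (1990), §14.5 p. 237 (print): «`T_{G′}(f′)` is the trace of `ρ(f′)` on `L(G′)`».
* [GelfandGraevPiatetskiShapiro1969] I. M. Gelfand, M. I. Graev, I. I. Piatetski-Shapiro (1969), Ch. 1 §2.
-/

set_option autoImplicit false
set_option linter.dupNamespace false

noncomputable section

namespace Summit.HodgeConjecture.HodgeConjecture.Cruxes.H413.F0P3aStubS1TraceFormula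

open Summit.HodgeConjecture.HodgeConjecture.Cruxes.H413.F0P3aStubS1TraceFunctional
open MeasureTheory Measure Set Filter Topology NumberField IsDedekindDomain CompactlySupported
open Literature.NumberTheory.Automorphic
open Literature.MeasureTheory.Group
open Literature.AlgebraicGeometry.ShimuraVarieties (hermForm)
open scoped ENNReal NNReal

/-! ## §1 The diagonal of the kernel and the explicit trace functional (generic adelic group datum, compact quotient) -/

section Datum

universe u

variable {K : Type} [Field K] [NumberField K] (𝒢 : AdelicGroupData.{u} K)
  (μ : Measure 𝒢.automorphicQuotient) [𝒢.IsAutomorphicMeasure μ]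
  [LocallyCompactSpace 𝒢.Adelic] [SecondCountableTopology 𝒢.Adelic] [T2Space 𝒢.Adelic]
  [MeasurableSpace 𝒢.Adelic] [BorelSpace 𝒢.Adelic]
  [hH : IsClosed (𝒢.quotientSubgroup : Set 𝒢.Adelic)]
  (ρ : Measure 𝒢.quotientSubgroup) [ρ.IsMulLeftInvariant] [ρ.IsMulRightInvariant]
  [IsFiniteMeasureOnCompacts ρ] [SFinite ρ]

/-- **The diagonal `x ↦ K_F(x, x)` of the kernel of `F ∈ C_c(G(𝔸_K))` is `μ`-integrable on a compact automorphic quotient** (it is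
continuous, ★ `stronglyMeasurable_uncurry_quotientKernel`, and bounded, ★ `exists_norm_quotientKernel_le'`, on a space of finite measure).
The quotient carries the tree's Borel structure `AdelicGroupData.measurableSpaceQuotientForm` (inlined). [cite: Gelbart1975, (9.11)] -/
theorem integrable_quotientKernel_diag [CompactSpace 𝒢.automorphicQuotient] (F : C_c(𝒢.Adelic, ℂ)) :
    (letI := AdelicGroupData.measurableSpaceQuotientForm 𝒢
    haveI := AdelicGroupData.borelSpaceQuotientForm 𝒢
    Integrable (fun x : 𝒢.automorphicQuotient => quotientKernel 𝒢.quotientSubgroup ρ F x x) μ) := by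
  letI := AdelicGroupData.measurableSpaceQuotientForm 𝒢
  haveI := AdelicGroupData.borelSpaceQuotientForm 𝒢
  obtain ⟨C, hC⟩ := AdelicGroupData.exists_norm_quotientKernel_le' 𝒢 ρ F
  have hK := AdelicGroupData.stronglyMeasurable_uncurry_quotientKernel 𝒢 ρ F
  have hm : AEStronglyMeasurable
      (fun x : 𝒢.automorphicQuotient => quotientKernel 𝒢.quotientSubgroup ρ F x x) μ :=
    (hK.comp_measurable (measurable_id.prodMk measurable_id)).aestronglyMeasurable
  exact (integrable_const C).mono' hm (Eventually.of_forall fun x => hC x x)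

/-- **`F ↦ ∫_X K_F(x, x) dμ` is additive** on `C_c(G(𝔸_K), ℂ)` (★ `quotientKernel_add` under the integral, both diagonals integrable).
[cite: GelfandGraevPiatetskiShapiro1969, Ch. 1 §2] -/
theorem integral_quotientKernel_diag_add [CompactSpace 𝒢.automorphicQuotient] (F G : C_c(𝒢.Adelic, ℂ)) :
    (letI := AdelicGroupData.measurableSpaceQuotientForm 𝒢
    haveI := AdelicGroupData.borelSpaceQuotientForm 𝒢
    ∫ x, quotientKernel 𝒢.quotientSubgroup ρ (⇑(F + G)) x x ∂μ =
      ∫ x, quotientKernel 𝒢.quotientSubgroup ρ F x x ∂μ + ∫ x, quotientKernel 𝒢.quotientSubgroup ρ G x x ∂μ) := by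
  letI := AdelicGroupData.measurableSpaceQuotientForm 𝒢
  haveI := AdelicGroupData.borelSpaceQuotientForm 𝒢
  refine (integral_congr_ae (Eventually.of_forall fun x => ?_)).trans
    (integral_add (integrable_quotientKernel_diag 𝒢 μ ρ F) (integrable_quotientKernel_diag 𝒢 μ ρ G))
  change quotientKernel 𝒢.quotientSubgroup ρ (⇑(F + G)) x x =
    quotientKernel 𝒢.quotientSubgroup ρ F x x + quotientKernel 𝒢.quotientSubgroup ρ G x x
  rw [CompactlySupportedContinuousMap.coe_add]
  exact quotientKernel_add 𝒢.quotientSubgroup ρ F.continuous F.hasCompactSupport G.continuous G.hasCompactSupport x x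

omit [𝒢.IsAutomorphicMeasure μ] [IsFiniteMeasureOnCompacts ρ] in
/-- **`F ↦ ∫_X K_F(x, x) dμ` is homogeneous**: `∫ K_{aF}(x, x) = a ∫ K_F(x, x)` (★ `quotientKernel_const_smul`; no integrability needed).
[cite: GelfandGraevPiatetskiShapiro1969, Ch. 1 §2] -/
theorem integral_quotientKernel_diag_smul (a : ℂ) (F : C_c(𝒢.Adelic, ℂ)) :
    (letI := AdelicGroupData.measurableSpaceQuotientForm 𝒢
    haveI := AdelicGroupData.borelSpaceQuotientForm 𝒢
    ∫ x, quotientKernel 𝒢.quotientSubgroup ρ (⇑(a • F)) x x ∂μ = a * ∫ x, quotientKernel 𝒢.quotientSubgroup ρ F x x ∂μ) := by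
  letI := AdelicGroupData.measurableSpaceQuotientForm 𝒢
  haveI := AdelicGroupData.borelSpaceQuotientForm 𝒢
  refine (integral_congr_ae (Eventually.of_forall fun x => ?_)).trans
    (integral_const_mul a fun x => quotientKernel 𝒢.quotientSubgroup ρ F x x)
  change quotientKernel 𝒢.quotientSubgroup ρ (⇑(a • F)) x x = a * quotientKernel 𝒢.quotientSubgroup ρ F x x
  rw [CompactlySupportedContinuousMap.coe_smul]
  exact quotientKernel_const_smul 𝒢.quotientSubgroup ρ a (⇑F) x x

variable [ρ.IsInvInvariant] (ν : Measure 𝒢.Adelic) [IsHaarMeasure ν] [ν.IsInvInvariant]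

/-- **The trace functional, EXPLICIT** (answers NOTE-R1-7): under the hypotheses of ★ `exists_traceFunctional` there is a `ℂ`-linear
`θ : C_c(G(𝔸_K), ℂ) →ₗ[ℂ] ℂ` with, for EVERY `F ∈ C_c`, `θ(F) = c⁻¹ ∫_X K_F(x, x) dμ(x)` (`c = unfoldingConstant H ρ μ ν`, the quotient carrying
the tree's Borel structure ∕ invariance ∕ finiteness instances `…QuotientForm`, inlined), AND the S1 clause: for every `f′`, every `F′` agreeing
pointwise with `f′ ⋆ f′^*` and every countable Hilbert basis `(e_i)` of `L²(X, μ)`, `Σ_i ‖R(f′) e_i‖² = Re θ(F′)`, `Im θ(F′) = 0`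
(★ `hasSum_norm_sq_integratedOperator_rightRegular_eq_diagonal`; linearity by `integral_quotientKernel_diag_add` ∕ `…_smul`).
[cite: Gelbart1975, (9.11) and Lemma 10.6] -/
theorem exists_traceFunctional_eq [CompactSpace 𝒢.automorphicQuotient] (hρ : ρ ≠ 0) :
    ∃ θ : C_c(𝒢.Adelic, ℂ) →ₗ[ℂ] ℂ,
      (∀ F : C_c(𝒢.Adelic, ℂ), θ F =
        (letI := AdelicGroupData.measurableSpaceQuotientForm 𝒢
        haveI := AdelicGroupData.borelSpaceQuotientForm 𝒢
        haveI := AdelicGroupData.smulInvariantMeasureQuotientForm 𝒢 μ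
        haveI := AdelicGroupData.isFiniteMeasureOnCompactsQuotientForm 𝒢 μ
        (((unfoldingConstant 𝒢.quotientSubgroup ρ μ ν : ℝ)⁻¹ : ℂ)) * ∫ x, quotientKernel 𝒢.quotientSubgroup ρ F x x ∂μ)) ∧
      ∀ (f' F' : C_c(𝒢.Adelic, ℂ)), (∀ x, F' x = mulConv ν (⇑f') (mulStar (⇑f')) x) →
        ∀ {ι : Type} [Countable ι] (b : HilbertBasis ι ℂ (𝒢.L2 μ)),
          HasSum (fun i => (‖(𝒢.rightRegular μ).integratedOperator (𝒢.isUnitary_rightRegular μ)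
              (𝒢.isStronglyContinuous_rightRegular_holds μ) ν f' (b i)‖ ^ 2 : ℝ)) (θ F').re ∧ (θ F').im = 0 := by
  letI := AdelicGroupData.measurableSpaceQuotientForm 𝒢
  haveI := AdelicGroupData.borelSpaceQuotientForm 𝒢
  haveI := AdelicGroupData.smulInvariantMeasureQuotientForm 𝒢 μ
  haveI := AdelicGroupData.isFiniteMeasureOnCompactsQuotientForm 𝒢 μ
  refine ⟨{ toFun := fun F => (((unfoldingConstant 𝒢.quotientSubgroup ρ μ ν : ℝ)⁻¹ : ℂ)) *
              ∫ x, quotientKernel 𝒢.quotientSubgroup ρ F x x ∂μ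
            map_add' := fun F G => by rw [integral_quotientKernel_diag_add 𝒢 μ ρ F G, mul_add]
            map_smul' := fun a F => by
              rw [integral_quotientKernel_diag_smul 𝒢 μ ρ a F, RingHom.id_apply, smul_eq_mul, mul_left_comm] },
    fun F => rfl, ?_⟩
  intro f' F' hF' ι _ b
  have hFeq : (⇑F' : 𝒢.Adelic → ℂ) = mulConv ν (⇑f') (mulStar (⇑f')) := funext hF'
  have h1 := AdelicGroupData.hasSum_norm_sq_integratedOperator_rightRegular_eq_diagonal 𝒢 μ ρ ν hρ f' b
  rw [← hFeq] at h1
  obtain ⟨hre, him⟩ := (Complex.hasSum_iff _ _).1 h1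
  simp only [Complex.ofReal_re, Complex.ofReal_im] at hre him
  exact ⟨hre, him.unique hasSum_zero⟩

end Datum

/-! ## §2 The explicit functional for `U(H)`, `H ∈ M₃(L)` anisotropic over a CM field -/

section Closer

variable (L : Type) [Field L] [NumberField L] [IsCMField L] (H : Matrix (Fin 3) (Fin 3) L)
  [MeasurableSpace (UnitaryGroup.cmDatum L 3 H).Adelic] [BorelSpace (UnitaryGroup.cmDatum L 3 H).Adelic]
  (μ : Measure (UnitaryGroup.cmDatum L 3 H).automorphicQuotient) [(UnitaryGroup.cmDatum L 3 H).IsAutomorphicMeasure μ]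
  (ρ : Measure (UnitaryGroup.cmDatum L 3 H).quotientSubgroup) [ρ.IsMulLeftInvariant] [ρ.IsMulRightInvariant] [ρ.IsInvInvariant]
  [IsFiniteMeasureOnCompacts ρ] [SFinite ρ]
  (ν : Measure (UnitaryGroup.cmDatum L 3 H).Adelic) [ν.IsHaarMeasure] [ν.IsInvInvariant]

/-- **S1 with the EXPLICIT `θ`** for the inner form `G′ = U(H)`, `H` anisotropic: for every two-sided and inversion-invariant measure `ρ ≠ 0`
on the DISCRETE subgroup `U(H)(L⁺)` (★ `discreteTopology_cmDatum_quotientSubgroup`; e.g. `Measure.count`, the choice of `stubS1_holds`),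
finite on compact sets, there is a `ℂ`-linear `θ` on `C_c(U(H)(𝔸_{L⁺}), ℂ)` with `θ(F) = c⁻¹ ∫_X K_F(x, x) dμ` for all `F` (closedness of
`U(H)(L⁺)` and the quotient's Borel structure inlined) and the S1 clause (compact quotient ★ `compactSpace_cmDatum_automorphicQuotient`).
[cite: Rogawski1990, §14.5 p. 237] [cite: Gelbart1975, (9.11) and Lemma 10.6] -/
theorem stubS1_explicit (hanis : ∀ x : Fin 3 → L, hermForm (cmConjRingHom L) H x x = 0 → x = 0) (hρ : ρ ≠ 0) :
    ∃ θ : CompactlySupportedContinuousMap (UnitaryGroup.cmDatum L 3 H).Adelic ℂ →ₗ[ℂ] ℂ,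
      (∀ F : CompactlySupportedContinuousMap (UnitaryGroup.cmDatum L 3 H).Adelic ℂ, θ F =
        (haveI := discreteTopology_cmDatum_quotientSubgroup L H
        haveI : IsClosed ((UnitaryGroup.cmDatum L 3 H).quotientSubgroup : Set (UnitaryGroup.cmDatum L 3 H).Adelic) :=
          Subgroup.isClosed_of_discrete
        letI := AdelicGroupData.measurableSpaceQuotientForm (UnitaryGroup.cmDatum L 3 H)
        haveI := AdelicGroupData.borelSpaceQuotientForm (UnitaryGroup.cmDatum L 3 H)
        haveI := AdelicGroupData.smulInvariantMeasureQuotientForm (UnitaryGroup.cmDatum L 3 H) μ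
        haveI := AdelicGroupData.isFiniteMeasureOnCompactsQuotientForm (UnitaryGroup.cmDatum L 3 H) μ
        (((unfoldingConstant (UnitaryGroup.cmDatum L 3 H).quotientSubgroup ρ μ ν : ℝ)⁻¹ : ℂ)) *
          ∫ x, quotientKernel (UnitaryGroup.cmDatum L 3 H).quotientSubgroup ρ F x x ∂μ)) ∧
      ∀ (f' F' : CompactlySupportedContinuousMap (UnitaryGroup.cmDatum L 3 H).Adelic ℂ),
        (∀ x, F' x = mulConv ν (⇑f') (mulStar (⇑f')) x) →
        ∀ {ι : Type} [Countable ι] (b : HilbertBasis ι ℂ ((UnitaryGroup.cmDatum L 3 H).L2 μ)),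
          HasSum (fun i => (‖((UnitaryGroup.cmDatum L 3 H).rightRegular μ).integratedOperator
              ((UnitaryGroup.cmDatum L 3 H).isUnitary_rightRegular μ)
              ((UnitaryGroup.cmDatum L 3 H).isStronglyContinuous_rightRegular_holds μ) ν f' (b i)‖ ^ 2 : ℝ))
            (θ F').re ∧ (θ F').im = 0 := by
  haveI : CompactSpace (UnitaryGroup.cmDatum L 3 H).automorphicQuotient :=
    UnitaryGroup.compactSpace_cmDatum_automorphicQuotient L 3 H hanis
  haveI := discreteTopology_cmDatum_quotientSubgroup L H
  haveI : IsClosed ((UnitaryGroup.cmDatum L 3 H).quotientSubgroup : Set (UnitaryGroup.cmDatum L 3 H).Adelic) :=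
    Subgroup.isClosed_of_discrete
  exact exists_traceFunctional_eq (UnitaryGroup.cmDatum L 3 H) μ ρ ν hρ

end Closer

/-! ## §3 Non-vacuity of S1: the Hilbert–Schmidt sums are positive for a Dirac-like `f′`, so `θ ≠ 0` -/

section NonVacuity

universe u

variable {K : Type} [Field K] [NumberField K] (𝒢 : AdelicGroupData.{u} K)
  (μ : Measure 𝒢.automorphicQuotient) [𝒢.IsAutomorphicMeasure μ]
  [LocallyCompactSpace 𝒢.Adelic] [MeasurableSpace 𝒢.Adelic] [BorelSpace 𝒢.Adelic]
  (ν : Measure 𝒢.Adelic) [IsHaarMeasure ν]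

/-- **`R(f′) ≠ 0` for a Dirac-like test function**, in Hilbert–Schmidt form: for every adelic group datum with `G(𝔸_K)` locally compact,
every automorphic `μ` and Haar `ν` there is `f′ ∈ C_c(G(𝔸_K), ℂ)` (a non-negative bump near `1`, ★ `exists_dirac_function'`) such that
for EVERY Hilbert basis `(e_i)` of `L²(X, μ)` the Hilbert–Schmidt sum `Σ_i ‖R(f′) e_i‖²`, whenever it converges to `S`, has `S > 0`:
`R(f′) v ≠ 0` for the constant `v = 1 ≠ 0` (★ `exists_nhds_integratedOperator_apply_ne_zero`; `μ ≠ 0` is finite), hence some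
`R(f′) e_i ≠ 0` (else `R(f′) v = Σ_i ⟨e_i, v⟩ R(f′) e_i = 0`). [cite: Gelbart1975, Lemma 10.6] -/
theorem exists_hasSum_norm_sq_integratedOperator_pos :
    ∃ f' : C_c(𝒢.Adelic, ℂ), ∀ {ι : Type*} (b : HilbertBasis ι ℂ (𝒢.L2 μ)) (S : ℝ),
      HasSum (fun i => (‖(𝒢.rightRegular μ).integratedOperator (𝒢.isUnitary_rightRegular μ)
          (𝒢.isStronglyContinuous_rightRegular_holds μ) ν f' (b i)‖ ^ 2 : ℝ)) S → 0 < S := by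
  have hu := 𝒢.isUnitary_rightRegular μ
  have hc := 𝒢.isStronglyContinuous_rightRegular_holds μ
  -- a non-zero vector of `L²(X, μ)`: the constant `1` (`μ` is finite and non-zero)
  have hμ : μ ≠ 0 := AdelicGroupData.IsAutomorphicMeasure.ne_zero 𝒢 μ
  set v : 𝒢.L2 μ := indicatorConstLp 2 MeasurableSet.univ (measure_ne_top μ _) (1 : ℂ) with hv
  have hv0 : v ≠ 0 := by
    intro h0
    have hn : ‖v‖ = ‖(1 : ℂ)‖ * μ.real Set.univ ^ (1 / (2 : ℝ≥0∞).toReal) :=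
      norm_indicatorConstLp two_ne_zero ENNReal.ofNat_ne_top
    rw [h0, norm_zero, norm_one, one_mul] at hn
    have hpos : 0 < μ.real Set.univ :=
      ENNReal.toReal_pos (measure_univ_ne_zero.2 hμ) (measure_ne_top μ _)
    have := Real.rpow_pos_of_pos hpos (1 / (2 : ℝ≥0∞).toReal)
    linarith
  obtain ⟨U, hU, hUf⟩ := ContRepresentation.exists_nhds_integratedOperator_apply_ne_zero hu hc ν hv0
  obtain ⟨f, hfre, hfU, hfpos⟩ := exists_dirac_function' ν hU
  refine ⟨f, fun {ι} b S hS => ?_⟩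
  have hTv : (𝒢.rightRegular μ).integratedOperator hu hc ν f v ≠ 0 := hUf f hfre hfU hfpos
  -- some basis vector is not killed by `R(f)`
  obtain ⟨i₀, hi₀⟩ : ∃ i, (𝒢.rightRegular μ).integratedOperator hu hc ν f (b i) ≠ 0 := by
    by_contra hall
    push Not at hall
    apply hTv
    have h1 := ((𝒢.rightRegular μ).integratedOperator hu hc ν f).hasSum (b.hasSum_repr v)
    have h2 : (fun i => (𝒢.rightRegular μ).integratedOperator hu hc ν f (b.repr v i • b i)) = fun _ => 0 := by
      funext i
      rw [map_smul, hall i, smul_zero]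
    rw [h2] at h1
    exact h1.unique hasSum_zero
  have hle : ‖(𝒢.rightRegular μ).integratedOperator hu hc ν f (b i₀)‖ ^ 2 ≤ S :=
    le_hasSum hS i₀ fun j _ => sq_nonneg _
  exact lt_of_lt_of_le (pow_pos (norm_pos_iff.2 hi₀) 2) hle

variable (L : Type) [Field L] [NumberField L] [IsCMField L] (H : Matrix (Fin 3) (Fin 3) L)
  [MeasurableSpace (UnitaryGroup.cmDatum L 3 H).Adelic] [BorelSpace (UnitaryGroup.cmDatum L 3 H).Adelic]
  (μ : Measure (UnitaryGroup.cmDatum L 3 H).automorphicQuotient) [(UnitaryGroup.cmDatum L 3 H).IsAutomorphicMeasure μ]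
  (ν : Measure (UnitaryGroup.cmDatum L 3 H).Adelic) [ν.IsHaarMeasure]

/-- **S1 is NON-VACUOUS** (referee R1 (ii): `θ := 0` fails the clause): for `U(H)` there is a pair `(f′, F′)` with `F′ = f′ ⋆ f′^*` pointwise
(★ `mulConvMulStar_nonvacuous`) such that for every Hilbert basis of `L²(U(H)(L⁺)\U(H)(𝔸_{L⁺}), μ)` the Hilbert–Schmidt sum of `R(f′)`,
if it converges to `S`, has `S > 0` (`exists_hasSum_norm_sq_integratedOperator_pos`). No anisotropy needed. [cite: Gelbart1975, Lemma 10.6] -/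
theorem stubS1_nonvacuous :
    ∃ (f' F' : CompactlySupportedContinuousMap (UnitaryGroup.cmDatum L 3 H).Adelic ℂ),
      (∀ x, F' x = mulConv ν (⇑f') (mulStar (⇑f')) x) ∧
      ∀ {ι : Type} (b : HilbertBasis ι ℂ ((UnitaryGroup.cmDatum L 3 H).L2 μ)) (S : ℝ),
        HasSum (fun i => (‖((UnitaryGroup.cmDatum L 3 H).rightRegular μ).integratedOperator
            ((UnitaryGroup.cmDatum L 3 H).isUnitary_rightRegular μ)
            ((UnitaryGroup.cmDatum L 3 H).isStronglyContinuous_rightRegular_holds μ) ν f' (b i)‖ ^ 2 : ℝ)) S → 0 < S := by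
  obtain ⟨f', hf'⟩ := exists_hasSum_norm_sq_integratedOperator_pos (UnitaryGroup.cmDatum L 3 H) μ ν
  obtain ⟨F', hF'⟩ := mulConvMulStar_nonvacuous ν f'
  exact ⟨f', F', hF', fun b S hS => hf' b S hS⟩

/-- Hence **every** functional `θ` satisfying the S1 clause takes a value with POSITIVE real part (in particular non-zero) on some
`F′ = f′ ⋆ f′^*` (given any countable Hilbert basis of `L²` to instantiate the clause): S1 is not closable by the zero functional.
[cite: Gelbart1975, Lemma 10.6] -/
theorem stubS1_re_pos (θ : CompactlySupportedContinuousMap (UnitaryGroup.cmDatum L 3 H).Adelic ℂ →ₗ[ℂ] ℂ)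
    (hθ : ∀ (f' F' : CompactlySupportedContinuousMap (UnitaryGroup.cmDatum L 3 H).Adelic ℂ),
        (∀ x, F' x = mulConv ν (⇑f') (mulStar (⇑f')) x) →
        ∀ {ι : Type} [Countable ι] (b : HilbertBasis ι ℂ ((UnitaryGroup.cmDatum L 3 H).L2 μ)),
          HasSum (fun i => (‖((UnitaryGroup.cmDatum L 3 H).rightRegular μ).integratedOperator
              ((UnitaryGroup.cmDatum L 3 H).isUnitary_rightRegular μ)
              ((UnitaryGroup.cmDatum L 3 H).isStronglyContinuous_rightRegular_holds μ) ν f' (b i)‖ ^ 2 : ℝ))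
            (θ F').re ∧ (θ F').im = 0)
    {ι : Type} [Countable ι] (b : HilbertBasis ι ℂ ((UnitaryGroup.cmDatum L 3 H).L2 μ)) :
    ∃ F' : CompactlySupportedContinuousMap (UnitaryGroup.cmDatum L 3 H).Adelic ℂ, 0 < (θ F').re ∧ θ F' ≠ 0 := by
  obtain ⟨f', F', hF', hpos⟩ := stubS1_nonvacuous L H μ ν
  refine ⟨F', hpos b _ (hθ f' F' hF' b).1, fun h0 => ?_⟩
  have h := hpos b _ (hθ f' F' hF' b).1
  rw [h0, Complex.zero_re] at h
  exact lt_irrefl _ h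

end NonVacuity

end Summit.HodgeConjecture.HodgeConjecture.Cruxes.H413.F0P3aStubS1TraceFormula

end
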